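import Summits.QuantumFields.YangMills.Theses.FemtoCutoffLadder
import Summits.QuantumFields.YangMills.Theorems.FemtoCutoffLadderWalledSecondPos
import HarnessLib

/-!
# Route `FemtoCutoffLadder`, LINE g5-A «one plaquette wall at a time»: the ADDITIVE form of the wall items, by name

Seat `leafhand-qf-femtocutoffladder-1` g0 (2026-08-30).  With every walled top value `t Q` (`SFCompression.walledTop_pos`, p615421) and every walled
second value `s Q` (`SFCompression.walledSecond_pos`, p793746) positive on the femto window, the pair of cross-multiplied comparison clauses of
`LocalWallStep` (stmt-QuantumFields-26282), `SingleWallStep` (26631) and `LastWallStep` (26638) is EQUIVALENT to one absolute bound on the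
difference of the logarithmic femto gap variables `z_Q := L·(log t Q − log s Q)` (`SFCompression.wallComparisons_iff_abs_le`):

* ★ `localWallStep_iff_abs_log : LocalWallStep ↔ ∀ κ … ∀ Q, ∀ p₀ ∉ Q, |z_Q − z_{Q ∪ {p₀}}| ≤ A/(β²·N)` (same quantifier prefix, same `let`s, VERBATIM);
* `singleWallStep_iff_abs_log`, `lastWallStep_iff_abs_log` — the two extreme wall sets.

This is the currency in which the line is sized and probed (`Cruxes/SingleWallStep/SIZING-fcl-p3-g8.md`: «the item is |g_B − E₁| ≤ A/(3β²L⁴)»;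
instrument row «|z_κ − z|·β²»).  HONEST FRAMING: a by-name door (bookkeeping with `Real.log`); the bound itself — an open two-cutoff statement behind
`UVStabilityNonUniqueness` — is untouched.  R2b1 is a RECORD rung: not infinite volume, not a mass gap, not Clay; no summit is proved by this file.
No definitions, no named facts, no `sorry`.
-/

set_option autoImplicit false

noncomputable section

namespace Summit.QuantumFields.YangMills.Theorems.FemtoCutoffLadder

open Literature.MathematicalPhysics.QuantumFieldTheory hiding SU2
open Summit.QuantumFields.YangMills.Theorems.FemtoTransferGap
open Summit.QuantumFields.YangMills.Theses.FemtoCutoffLadder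

/-- ★ **`LocalWallStep` ⟺ its additive form**: along the femto window, for every wall set `Q` and `p₀ ∉ Q`, `|z_Q − z_{Q ∪ {p₀}}| ≤ A/(β²N)` with
`z_Q = L·(log t Q − log s Q)` — the positivity clauses are automatic (`walledTop_pos`) and the two cross-multiplied clauses are the two signs of the
absolute value (`wallComparisons_iff_abs_le`, `walledSecond_pos`). [folklore] -/
theorem localWallStep_iff_abs_log :
    LocalWallStep ↔
      (∀ κ : ℝ, 0 < κ → κ < 1 → ∃ (A lam0 : ℝ) (L0 : ℕ), 0 ≤ A ∧ 0 < lam0 ∧ ∀ lam : ℝ, 0 < lam → lam ≤ lam0 → ∀ (L : ℕ) [NeZero L], L0 ≤ L → ∀ β : ℝ, InFemtoWindow lam β L → let W : Set (Literature.MathematicalPhysics.QuantumFieldTheory.Plaquette 3 L) → (Literature.MathematicalPhysics.QuantumFieldTheory.GaugeConfig 3 L SU2 → ℝ) → Prop := fun Q ψ => ∀ U, (∃ p ∈ Q, β ^ (κ - 1) < 2 - (su2Rep (Literature.MathematicalPhysics.QuantumFieldTheory.plaquetteHolonomy U p.1 p.2.1.1 p.2.1.2)).trace.re) → ψ U = 0;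 let t : Set (Literature.MathematicalPhysics.QuantumFieldTheory.Plaquette 3 L) → ℝ := fun Q => sSup (rayleighSet su2Rep L β (W Q)); let s : Set (Literature.MathematicalPhysics.QuantumFieldTheory.Plaquette 3 L) → ℝ := fun Q => sInf {x : ℝ | ∃ φ : Literature.MathematicalPhysics.QuantumFieldTheory.GaugeConfig 3 L SU2 → ℝ, IsPhys φ ∧ x = sSup (rayleighSet su2Rep L β fun ψ => W Q ψ ∧ l2 ψ φ = 0)}; ∀ (Q : Set (Literature.MathematicalPhysics.QuantumFieldTheory.Plaquette 3 L)) (p₀ : Literature.MathematicalPhysics.QuantumFieldTheory.Plaquette 3 L), p₀ ∉ Q → |(L : ℝ) * (Real.log (t Q) - Real.log (s Q)) - (L : ℝ) * (Real.log (t (insert p₀ Q)) - Real.log (s (insert p₀ Q)))| ≤ A / β ^ 2 / (Fintype.card (Literature.MathematicalPhysics.QuantumFieldTheory.Plaquette 3 L) : ℝ)) := by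
  constructor
  · intro h κ hκ hκ1
    obtain ⟨A, lam0, L0, hA, hlam0, H⟩ := h κ hκ hκ1
    refine ⟨A, lam0, L0, hA, hlam0, fun lam hlam hle L _ hL0 β hW => ?_⟩
    have hβ : 0 < β := by linarith [hW.1]
    intro W t s Q p₀ hp₀
    obtain ⟨ht, ht', hc⟩ := H lam hlam hle L hL0 β hW Q p₀ hp₀
    exact (SFCompression.wallComparisons_iff_abs_le (SFCompression.walledSecond_pos L hβ κ _) ht
      (SFCompression.walledSecond_pos L hβ κ _) ht' L).mp hc
  · intro h κ hκ hκ1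
    obtain ⟨A, lam0, L0, hA, hlam0, H⟩ := h κ hκ hκ1
    refine ⟨A, lam0, L0, hA, hlam0, fun lam hlam hle L _ hL0 β hW => ?_⟩
    have hβ : 0 < β := by linarith [hW.1]
    intro W t s Q p₀ hp₀
    have ht := SFCompression.walledTop_pos L hβ κ Q
    have ht' := SFCompression.walledTop_pos L hβ κ (insert p₀ Q)
    exact ⟨ht, ht', (SFCompression.wallComparisons_iff_abs_le (SFCompression.walledSecond_pos L hβ κ _) ht
      (SFCompression.walledSecond_pos L hβ κ _) ht' L).mpr (H lam hlam hle L hL0 β hW Q p₀ hp₀)⟩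

/-- **`SingleWallStep` ⟺ its additive form** (`Q = ∅`: one wall on the bare femto transfer matrix moves `z` by at most `A/(β²N)`). [folklore] -/
theorem singleWallStep_iff_abs_log :
    SingleWallStep ↔
      (∀ κ : ℝ, 0 < κ → κ < 1 → ∃ (A lam0 : ℝ) (L0 : ℕ), 0 ≤ A ∧ 0 < lam0 ∧ ∀ lam : ℝ, 0 < lam → lam ≤ lam0 → ∀ (L : ℕ) [NeZero L], L0 ≤ L → ∀ β : ℝ, InFemtoWindow lam β L → let W : Set (Literature.MathematicalPhysics.QuantumFieldTheory.Plaquette 3 L) → (Literature.MathematicalPhysics.QuantumFieldTheory.GaugeConfig 3 L SU2 → ℝ) → Prop := fun Q ψ => ∀ U, (∃ p ∈ Q, β ^ (κ - 1) < 2 - (su2Rep (Literature.MathematicalPhysics.QuantumFieldTheory.plaquetteHolonomy U p.1 p.2.1.1 p.2.1.2)).trace.re) → ψ U = 0; let t : Set (Literature.MathematicalPhysics.QuantumFieldTheory.Plaquette 3 L) → ℝ := fun Q => sSup (rayleighSet su2Rep L β (W Q)); let s : Set (Literature.MathematicalPhysics.QuantumFieldTheory.Plaquette 3 L) → ℝ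 := fun Q => sInf {x : ℝ | ∃ φ : Literature.MathematicalPhysics.QuantumFieldTheory.GaugeConfig 3 L SU2 → ℝ, IsPhys φ ∧ x = sSup (rayleighSet su2Rep L β fun ψ => W Q ψ ∧ l2 ψ φ = 0)}; ∀ p₀ : Literature.MathematicalPhysics.QuantumFieldTheory.Plaquette 3 L, |(L : ℝ) * (Real.log (t (∅ : Set (Literature.MathematicalPhysics.QuantumFieldTheory.Plaquette 3 L))) - Real.log (s (∅ : Set (Literature.MathematicalPhysics.QuantumFieldTheory.Plaquette 3 L)))) - (L : ℝ) * (Real.log (t (insert p₀ (∅ : Set (Literature.MathematicalPhysics.QuantumFieldTheory.Plaquette 3 L)))) - Real.log (s (insert p₀ (∅ : Set (Literature.MathematicalPhysics.QuantumFieldTheory.Plaquette 3 L)))))| ≤ A / β ^ 2 / (Fintype.card (Literature.MathematicalPhysics.QuantumFieldTheory.Plaquette 3 L) : ℝ)) := by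
  constructor
  · intro h κ hκ hκ1
    obtain ⟨A, lam0, L0, hA, hlam0, H⟩ := h κ hκ hκ1
    refine ⟨A, lam0, L0, hA, hlam0, fun lam hlam hle L _ hL0 β hW => ?_⟩
    have hβ : 0 < β := by linarith [hW.1]
    intro W t s p₀
    obtain ⟨ht, ht', hc⟩ := H lam hlam hle L hL0 β hW p₀
    exact (SFCompression.wallComparisons_iff_abs_le (SFCompression.walledSecond_pos L hβ κ _) ht
      (SFCompression.walledSecond_pos L hβ κ _) ht' L).mp hc
  · intro h κ hκ hκ1
    obtain ⟨A, lam0, L0, hA, hlam0, H⟩ := h κ hκ hκ1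
    refine ⟨A, lam0, L0, hA, hlam0, fun lam hlam hle L _ hL0 β hW => ?_⟩
    have hβ : 0 < β := by linarith [hW.1]
    intro W t s p₀
    have ht := SFCompression.walledTop_pos L hβ κ (∅ : Set (Plaquette 3 L))
    have ht' := SFCompression.walledTop_pos L hβ κ (insert p₀ (∅ : Set (Plaquette 3 L)))
    exact ⟨ht, ht', (SFCompression.wallComparisons_iff_abs_le (SFCompression.walledSecond_pos L hβ κ _) ht
      (SFCompression.walledSecond_pos L hβ κ _) ht' L).mpr (H lam hlam hle L hL0 β hW p₀)⟩

/-- **`LastWallStep` ⟺ its additive form** (`Q = univ ∖ {p₀}`: the last wall moves `z` by at most `A/(β²N)`). [folklore] -/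
theorem lastWallStep_iff_abs_log :
    LastWallStep ↔
      (∀ κ : ℝ, 0 < κ → κ < 1 → ∃ (A lam0 : ℝ) (L0 : ℕ), 0 ≤ A ∧ 0 < lam0 ∧ ∀ lam : ℝ, 0 < lam → lam ≤ lam0 → ∀ (L : ℕ) [NeZero L], L0 ≤ L → ∀ β : ℝ, InFemtoWindow lam β L → let W : Set (Literature.MathematicalPhysics.QuantumFieldTheory.Plaquette 3 L) → (Literature.MathematicalPhysics.QuantumFieldTheory.GaugeConfig 3 L SU2 → ℝ) → Prop := fun Q ψ => ∀ U, (∃ p ∈ Q, β ^ (κ - 1) < 2 - (su2Rep (Literature.MathematicalPhysics.QuantumFieldTheory.plaquetteHolonomy U p.1 p.2.1.1 p.2.1.2)).trace.re) → ψ U = 0; let t : Set (Literature.MathematicalPhysics.QuantumFieldTheory.Plaquette 3 L) → ℝ := fun Q => sSup (rayleighSet su2Rep L β (W Q)); let s : Set (Literature.MathematicalPhysics.QuantumFieldTheory.Plaquette 3 L) → ℝ := fun Q => sInf {x : ℝ | ∃ φ : Literature.MathematicalPhysics.QuantumFieldTheory.GaugeConfig 3 L SU2 → ℝ, IsPhys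 φ ∧ x = sSup (rayleighSet su2Rep L β fun ψ => W Q ψ ∧ l2 ψ φ = 0)}; ∀ p₀ : Literature.MathematicalPhysics.QuantumFieldTheory.Plaquette 3 L, |(L : ℝ) * (Real.log (t ((Set.univ : Set (Literature.MathematicalPhysics.QuantumFieldTheory.Plaquette 3 L)) \ {p₀})) - Real.log (s ((Set.univ : Set (Literature.MathematicalPhysics.QuantumFieldTheory.Plaquette 3 L)) \ {p₀}))) - (L : ℝ) * (Real.log (t (insert p₀ ((Set.univ : Set (Literature.MathematicalPhysics.QuantumFieldTheory.Plaquette 3 L)) \ {p₀}))) - Real.log (s (insert p₀ ((Set.univ : Set (Literature.MathematicalPhysics.QuantumFieldTheory.Plaquette 3 L)) \ {p₀}))))| ≤ A / β ^ 2 / (Fintype.card (Literature.MathematicalPhysics.QuantumFieldTheory.Plaquette 3 L) : ℝ)) := by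
  constructor
  · intro h κ hκ hκ1
    obtain ⟨A, lam0, L0, hA, hlam0, H⟩ := h κ hκ hκ1
    refine ⟨A, lam0, L0, hA, hlam0, fun lam hlam hle L _ hL0 β hW => ?_⟩
    have hβ : 0 < β := by linarith [hW.1]
    intro W t s p₀
    obtain ⟨ht, ht', hc⟩ := H lam hlam hle L hL0 β hW p₀
    exact (SFCompression.wallComparisons_iff_abs_le (SFCompression.walledSecond_pos L hβ κ _) ht
      (SFCompression.walledSecond_pos L hβ κ _) ht' L).mp hc
  · intro h κ hκ hκ1
    obtain ⟨A, lam0, L0, hA, hlam0, H⟩ := h κ hκ hκ1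
    refine ⟨A, lam0, L0, hA, hlam0, fun lam hlam hle L _ hL0 β hW => ?_⟩
    have hβ : 0 < β := by linarith [hW.1]
    intro W t s p₀
    have ht := SFCompression.walledTop_pos L hβ κ ((Set.univ : Set (Plaquette 3 L)) \ {p₀})
    have ht' := SFCompression.walledTop_pos L hβ κ (insert p₀ ((Set.univ : Set (Plaquette 3 L)) \ {p₀}))
    exact ⟨ht, ht', (SFCompression.wallComparisons_iff_abs_le (SFCompression.walledSecond_pos L hβ κ _) ht
      (SFCompression.walledSecond_pos L hβ κ _) ht' L).mpr (H lam hlam hle L hL0 β hW p₀)⟩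

end Summit.QuantumFields.YangMills.Theorems.FemtoCutoffLadder

end
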